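import Literature.NumberTheory.LFunctions.ClassGroupSieveDensity
import HarnessLib

/-!
# The log-free mean value theorem for class group characters (Thorner–Zaman 2017, Thm. 4.2)

Topic `Literature/NumberTheory/LFunctions`, namespace `Literature.NumberTheory.LFunctions.NumberField`.
Everything here is PROVED (theorems only; no named facts).

For a number field `K`, complex numbers `b(𝔭)` attached to finitely many prime ideals `𝔭` all of
norm `> y ≥ z ≥ 1`, Weiss's kernel of order `m + 1 ≥ n_K + 4` and parameter `A > 0`, and
`0 < T` with `(m+1)T² ≤ 3A²`,

  `Σ_ψ ∫_{−T}^{T} |Σ_𝔭 b(𝔭) ψ([𝔭]) N𝔭^{−it}|² dt ≤ 8π · h_K M · Σ_𝔭 N𝔭 |b(𝔭)|²`,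
  `M = κ₀/V'(z) + |D_z|² err(log y − (m+1)/A) z`

(`classGroup_meanValue_le`), the sum over all characters `ψ` of `Cl_K`; here `κ₀ = κ_K/h_K`,
`V'(z) = Σ_{S ∈ D_z} 1/N𝔡_S ≥ e^{−n_K} V(z) ≫ e^{−n_K} κ_K log z` (`ClassGroupSieveDensity`), so that
`h_K M ≪ e^{n_K}/log z + h_K z^{2n_K+3} |d_K| e^{2n_K} C y^{−3/2}` — the **log-free large sieve**
for `Cl_K` ([ThornerZaman2017, Theorem 4.2 and (4-4)] with `H = P_K`, i.e. `Q = 1`).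
Ingredients: Gallagher's lemma with Weiss's kernel (`WeissKernel.gallagher`), Parseval on `Cl_K`
(`sum_norm_sq_charSum_eq`), Cauchy–Schwarz inside each class, and the sifted class sums
`ClassGroupSiftedSums.sifted_classSum_le` (a prime of norm `> z` is a `z`-sifted ideal).

## References

* [ThornerZaman2017] J. Thorner, A. Zaman, *An explicit bound for the least prime ideal in the
  Chebotarev density theorem*, Algebra Number Theory 11 (2017), Theorem 4.2, §4B.
* [Weiss1983] A. Weiss, *The least prime ideal*, J. reine angew. Math. 338 (1983), Theorem 4.2.
-/

noncomputable section

open Real Finset IsDedekindDomain Filter MeasureTheory Complex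
open scoped Topology

namespace Literature.NumberTheory.LFunctions.NumberField

open Literature.NumberTheory.LFunctions.WeissKernel Literature.NumberTheory.Sieve.Squarefree
  Literature.NumberTheory.LFunctions.AbelianDensity
open scoped nonZeroDivisors _root_.NumberField Classical

variable {K : Type*} [Field K] [NumberField K]

/-! ### Parseval on the class group -/

/-- **Parseval on `Cl_K`**: `Σ_ψ |Σ_C ψ(C) a(C)|² = h Σ_C |a(C)|²`. [folklore] -/
theorem sum_norm_sq_charSum_eq (a : ClassGroup (𝓞 K) → ℂ) :
    ∑ ψ : AddChar (Additive (ClassGroup (𝓞 K))) ℂ, ‖∑ C : ClassGroup (𝓞 K), ψ (Additive.ofMul C) * a C‖ ^ 2 =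
      Fintype.card (ClassGroup (𝓞 K)) * ∑ C : ClassGroup (𝓞 K), ‖a C‖ ^ 2 := by
  apply Complex.ofReal_injective
  simp only [Complex.ofReal_sum, Complex.ofReal_mul, Complex.ofReal_natCast]
  have hsq : ∀ w : ℂ, ((‖w‖ ^ 2 : ℝ) : ℂ) = w * starRingEnd ℂ w := by
    intro w; rw [Complex.mul_conj, Complex.normSq_eq_norm_sq]
  simp_rw [hsq, map_sum, map_mul, Finset.sum_mul_sum]
  -- `conj ψ(C') = ψ(C'⁻¹)`
  have hconj : ∀ (ψ : AddChar (Additive (ClassGroup (𝓞 K))) ℂ) (C : ClassGroup (𝓞 K)),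
      starRingEnd ℂ (ψ (Additive.ofMul C)) = ψ (Additive.ofMul C⁻¹) := by
    intro ψ C
    rw [ofMul_inv, AddChar.map_neg_eq_inv, Complex.inv_eq_conj (AddChar.norm_apply ψ _)]
  have hterm : ∀ (ψ : AddChar (Additive (ClassGroup (𝓞 K))) ℂ) (C C' : ClassGroup (𝓞 K)),
      ψ (Additive.ofMul C) * a C * (starRingEnd ℂ (ψ (Additive.ofMul C')) * starRingEnd ℂ (a C')) =
        ψ (Additive.ofMul (C * C'⁻¹)) * (a C * starRingEnd ℂ (a C')) := by
    intro ψ C C'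
    rw [hconj, ofMul_mul, AddChar.map_add_eq_mul]; ring
  simp_rw [hterm]
  rw [Finset.sum_comm]
  simp_rw [Finset.sum_comm (s := (univ : Finset (AddChar (Additive (ClassGroup (𝓞 K))) ℂ))), ← Finset.sum_mul,
    sum_classGroupChar_apply_eq_ite, mul_inv_eq_one, ite_mul, zero_mul]
  rw [Finset.mul_sum]
  refine Finset.sum_congr rfl fun C _ ↦ ?_
  rw [Finset.sum_ite_eq univ C, if_pos (mem_univ _)]

/-! ### Integrability of the smoothed trigonometric sums -/

/-- `u ↦ |Σ_j c_j φ(u − l_j)|²` is integrable (bounded by `(A/2)(Σ|c_j|) · Σ_j |c_j| φ(u − l_j)`). [folklore] -/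
theorem integrable_norm_sq_sum_phi {A : ℝ} (hA : 0 < A) {m : ℕ} (hm : 1 ≤ m) {ι : Type*} (J : Finset ι)
    (c : ι → ℂ) (l : ι → ℝ) :
    Integrable fun u : ℝ ↦ ‖∑ j ∈ J, c j * (phi A m (u - l j) : ℂ)‖ ^ 2 := by
  set B : ℝ := A / 2 * ∑ j ∈ J, ‖c j‖ with hB
  have hcont : Continuous fun u : ℝ ↦ ∑ j ∈ J, c j * (phi A m (u - l j) : ℂ) :=
    continuous_finsetSum J fun j _ ↦ continuous_const.mul
      (Complex.continuous_ofReal.comp ((continuous_phi hA m hm).comp (continuous_id.sub continuous_const)))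
  refine Integrable.mono' ((integrable_finsetSum J fun j _ ↦
    ((integrable_phi A m).comp_sub_right (l j)).const_mul (B * ‖c j‖)))
    (hcont.norm.pow 2).aestronglyMeasurable (Eventually.of_forall fun u ↦ ?_)
  rw [Real.norm_eq_abs, abs_of_nonneg (by positivity)]
  have hG : ‖∑ j ∈ J, c j * (phi A m (u - l j) : ℂ)‖ ≤ ∑ j ∈ J, ‖c j‖ * phi A m (u - l j) := by
    refine (norm_sum_le _ _).trans (le_of_eq (Finset.sum_congr rfl fun j _ ↦ ?_))
    rw [norm_mul, Complex.norm_real, Real.norm_eq_abs, abs_of_nonneg (phi_nonneg hA m _)]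
  have hGB : ∑ j ∈ J, ‖c j‖ * phi A m (u - l j) ≤ B := by
    rw [hB, Finset.mul_sum]
    refine Finset.sum_le_sum fun j _ ↦ ?_
    rw [mul_comm (A / 2)]
    exact mul_le_mul_of_nonneg_left (phi_le hA m _) (norm_nonneg _)
  have hG0 : 0 ≤ ∑ j ∈ J, ‖c j‖ * phi A m (u - l j) :=
    Finset.sum_nonneg fun j _ ↦ mul_nonneg (norm_nonneg _) (phi_nonneg hA m _)
  calc ‖∑ j ∈ J, c j * (phi A m (u - l j) : ℂ)‖ ^ 2
      ≤ (∑ j ∈ J, ‖c j‖ * phi A m (u - l j)) ^ 2 := pow_le_pow_left₀ (norm_nonneg _) hG 2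
    _ ≤ B * ∑ j ∈ J, ‖c j‖ * phi A m (u - l j) := by rw [sq]; exact mul_le_mul_of_nonneg_right hGB hG0
    _ = ∑ j ∈ J, B * ‖c j‖ * phi A m (u - l j) := by rw [Finset.mul_sum]; simp_rw [mul_assoc]

/-! ### The pointwise bound in `u` -/

variable (K) in
/-- The constant `M = κ₀/V'(z) + |D_z|² err(log y − (m+1)/A) z` of the mean value theorem.
[cite: ThornerZaman2017, Theorem 4.2] -/
def meanValueConst (A : ℝ) (m : ℕ) (z y : ℝ) : ℝ :=
  (classTwistedZeta₁ K (fun _ ↦ (1 : ℂ)) 1 / Fintype.card (ClassGroup (𝓞 K))).re /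
      bigV (fun v : HeightOneSpectrum (𝓞 K) ↦ (Ideal.absNorm v.asIdeal : ℝ)) (admissible K z) +
    ((admissible K z).card : ℝ) ^ 2 * (lemma44Err K A m (Real.log y - ((m : ℝ) + 1) / A) * z)

/-- `M ≥ 0`. [folklore] -/
theorem meanValueConst_nonneg (A : ℝ) (m : ℕ) {z : ℝ} (hz : 1 ≤ z) (y : ℝ) : 0 ≤ meanValueConst K A m z y := by
  rw [meanValueConst]
  have hN : ∀ v : HeightOneSpectrum (𝓞 K), 1 < (Ideal.absNorm v.asIdeal : ℝ) := one_lt_absNorm_real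
  have hV := bigV_pos hN ⟨∅, empty_mem_admissible (K := K) hz⟩
  have hκ : 0 ≤ (classTwistedZeta₁ K (fun _ ↦ (1 : ℂ)) 1 / Fintype.card (ClassGroup (𝓞 K))).re := by
    rw [Complex.div_natCast_re]
    exact div_nonneg re_classTwistedZeta₁_one_nonneg (Nat.cast_nonneg _)
  have herr : 0 ≤ lemma44Err K A m (Real.log y - ((m : ℝ) + 1) / A) := by
    rw [lemma44Err]; have := majorConst_pos A m (Module.finrank ℚ K + 1); positivity
  have : 0 ≤ lemma44Err K A m (Real.log y - ((m : ℝ) + 1) / A) * z := mul_nonneg herr (by linarith)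
  positivity

/-- A prime of norm `> z` is a `z`-sifted ideal. [folklore] -/
theorem not_dvd_of_absNorm_lt {z : ℝ} {v w : HeightOneSpectrum (𝓞 K)} (hv : z < (Ideal.absNorm v.asIdeal : ℝ))
    (hw : (Ideal.absNorm w.asIdeal : ℝ) ≤ z) : ¬ w.asIdeal ∣ v.asIdeal := by
  intro h
  have : w = v := by
    refine HeightOneSpectrum.ext ?_
    exact ((v.isMaximal).eq_of_le w.isPrime.ne_top (Ideal.le_of_dvd h)).symm
  rw [this] at hw
  linarith

/-- **The sieve input per class**: for nonzero `z`-sifted ideals `𝔫 ∈ P` of norm `> y` in the class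
`C` and `u ≥ log y − (m+1)/A`, `Σ_{𝔫 ∈ P ∩ C} φ(u − log N𝔫)/N𝔫 ≤ M` (`sifted_classSum_le`). [folklore] -/
theorem sum_sifted_class_phi_div_le (Pset : Finset (Ideal (𝓞 K))) (C : ClassGroup (𝓞 K))
    {A : ℝ} (hA : 0 < A) {m : ℕ} (hm : Module.finrank ℚ K + 3 ≤ m) {z y : ℝ} (hz : 1 ≤ z)
    (h0 : ∀ I ∈ Pset, I ≠ ⊥)
    (hsft : ∀ I ∈ Pset, ∀ w : HeightOneSpectrum (𝓞 K), (Ideal.absNorm w.asIdeal : ℝ) ≤ z → ¬ w.asIdeal ∣ I)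
    {u : ℝ} (hu : Real.log y - ((m : ℝ) + 1) / A ≤ u) :
    ∑ I ∈ Pset with idealClass I = C,
        phi A m (u - Real.log (Ideal.absNorm I)) / (Ideal.absNorm I : ℝ) ≤
      meanValueConst K A m z y := by
  have hsift := sifted_classSum_le C hA hm u hz
  set X := ⌊Real.exp (u + ((m : ℝ) + 1) / A)⌋₊ with hX
  set Aset := (Ideal.finite_setOf_absNorm_le (S := 𝓞 K) X).toFinset with hAset
  set T := Aset.filter (fun I ↦ ∀ w : HeightOneSpectrum (𝓞 K), (Ideal.absNorm w.asIdeal : ℝ) ≤ z → ¬ w.asIdeal ∣ I)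
    with hT
  set w : Ideal (𝓞 K) → ℝ := fun I ↦ (if I ≠ ⊥ ∧ idealClass I = C then (1 : ℝ) else 0) *
    ((Ideal.absNorm I : ℕ) : ℝ)⁻¹ * phi A m (u - Real.log (Ideal.absNorm I)) with hw
  have hw0 : ∀ I, 0 ≤ w I := by
    intro I; rw [hw]; dsimp only
    refine mul_nonneg (mul_nonneg ?_ (by positivity)) (phi_nonneg hA m _)
    split_ifs <;> norm_num
  -- restrict to the ideals in the window (the others contribute `0`)
  set P' := (Pset.filter (fun I ↦ idealClass I = C)).filter (fun I ↦ Ideal.absNorm I ≤ X) with hP'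
  have hrestrict : ∑ I ∈ Pset with idealClass I = C,
      phi A m (u - Real.log (Ideal.absNorm I)) / (Ideal.absNorm I : ℝ) = ∑ I ∈ P', w I := by
    conv_rhs => rw [hP', Finset.sum_filter]
    refine Finset.sum_congr rfl fun I hI ↦ ?_
    obtain ⟨hIP, hIC⟩ := mem_filter.mp hI
    split_ifs with hle
    · rw [hw]; dsimp only
      rw [if_pos ⟨h0 I hIP, hIC⟩, one_mul, div_eq_inv_mul]
    · rw [not_le] at hle
      have : Real.exp (u + ((m : ℝ) + 1) / A) < Ideal.absNorm I := (Nat.floor_lt (Real.exp_pos _).le).mp hle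
      rw [show (Ideal.absNorm I : ℝ) = ((Ideal.absNorm I : ℕ) : ℝ) from rfl,
        phi_sub_log_eq_zero hA m u this, zero_div]
  rw [hrestrict]
  have hle1 : ∑ I ∈ P', w I ≤ ∑ I ∈ T, w I := by
    refine Finset.sum_le_sum_of_subset_of_nonneg ?_ fun I _ _ ↦ hw0 I
    intro I hI
    rw [hP', mem_filter, mem_filter] at hI
    obtain ⟨⟨hIP, -⟩, hIX⟩ := hI
    rw [hT, mem_filter, hAset, Set.Finite.mem_toFinset, Set.mem_setOf_eq]
    exact ⟨hIX, hsft I hIP⟩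
  have hsift' : ∑ I ∈ T, w I ≤
      (classTwistedZeta₁ K (fun _ ↦ (1 : ℂ)) 1 / Fintype.card (ClassGroup (𝓞 K))).re /
          bigV (fun v : HeightOneSpectrum (𝓞 K) ↦ (Ideal.absNorm v.asIdeal : ℝ)) (admissible K z) +
        ((admissible K z).card : ℝ) ^ 2 * (lemma44Err K A m u * z) := hsift
  refine hle1.trans (hsift'.trans ?_)
  rw [meanValueConst]
  refine add_le_add le_rfl (mul_le_mul_of_nonneg_left ?_ (sq_nonneg _))
  refine mul_le_mul_of_nonneg_right ?_ (by linarith)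
  exact lemma44Err_antitone (K := K) A m hu

/-- **The pointwise bound**: for nonzero `z`-sifted ideals `𝔫 ∈ P` of norm `> y ≥ z` and every real `u`,
`Σ_ψ |Σ_{𝔫∈P} b(𝔫) ψ([𝔫]) φ(u − log N𝔫)|² ≤ h M Σ_{𝔫∈P} N𝔫 |b(𝔫)|² φ(u − log N𝔫)`
(Parseval on `Cl_K`, Cauchy–Schwarz inside each class, `sum_sifted_class_phi_div_le`).
[cite: ThornerZaman2017, §4B, proof of Theorem 4.2] -/
theorem sum_norm_sq_smoothed_le (Pset : Finset (Ideal (𝓞 K))) (b : Ideal (𝓞 K) → ℂ)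
    {A : ℝ} (hA : 0 < A) {m : ℕ} (hm : Module.finrank ℚ K + 3 ≤ m) {z y : ℝ} (hz : 1 ≤ z) (hzy : z ≤ y)
    (h0 : ∀ I ∈ Pset, I ≠ ⊥)
    (hsft : ∀ I ∈ Pset, ∀ w : HeightOneSpectrum (𝓞 K), (Ideal.absNorm w.asIdeal : ℝ) ≤ z → ¬ w.asIdeal ∣ I)
    (hy : ∀ I ∈ Pset, y < (Ideal.absNorm I : ℝ)) (u : ℝ) :
    ∑ ψ : AddChar (Additive (ClassGroup (𝓞 K))) ℂ,
        ‖∑ I ∈ Pset, b I * ψ (Additive.ofMul (idealClass I)) *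
          (phi A m (u - Real.log (Ideal.absNorm I)) : ℂ)‖ ^ 2 ≤
      Fintype.card (ClassGroup (𝓞 K)) * meanValueConst K A m z y *
        ∑ I ∈ Pset, (Ideal.absNorm I : ℝ) * ‖b I‖ ^ 2 * phi A m (u - Real.log (Ideal.absNorm I)) := by
  set φv : Ideal (𝓞 K) → ℝ := fun I ↦ phi A m (u - Real.log (Ideal.absNorm I)) with hφv
  have hφ0 : ∀ I, 0 ≤ φv I := fun I ↦ phi_nonneg hA m _
  have hM0 := meanValueConst_nonneg (K := K) A m hz y
  have hcard : (0 : ℝ) ≤ Fintype.card (ClassGroup (𝓞 K)) := Nat.cast_nonneg _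
  change ∑ ψ : AddChar (Additive (ClassGroup (𝓞 K))) ℂ,
      ‖∑ I ∈ Pset, b I * ψ (Additive.ofMul (idealClass I)) * (φv I : ℂ)‖ ^ 2 ≤
    Fintype.card (ClassGroup (𝓞 K)) * meanValueConst K A m z y *
      ∑ I ∈ Pset, (Ideal.absNorm I : ℝ) * ‖b I‖ ^ 2 * φv I
  have hk : 0 < ((m : ℝ) + 1) / A := by positivity
  by_cases hu : Real.log y - ((m : ℝ) + 1) / A ≤ u
  swap
  · -- all `φ(u − log N𝔫) = 0`
    rw [not_le] at hu
    have hzero : ∀ I ∈ Pset, φv I = 0 := by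
      intro I hI
      have hNv : (0 : ℝ) < Ideal.absNorm I := by linarith [hy I hI]
      have hlog : Real.log y < Real.log (Ideal.absNorm I) := Real.log_lt_log (by linarith) (hy I hI)
      rw [hφv]; dsimp only
      refine phi_eq_zero_of_lt hA m ?_
      rw [abs_of_neg (by linarith)]
      linarith
    have hl : ∀ ψ : AddChar (Additive (ClassGroup (𝓞 K))) ℂ,
        ∑ I ∈ Pset, b I * ψ (Additive.ofMul (idealClass I)) * (φv I : ℂ) = 0 := by
      intro ψ
      exact Finset.sum_eq_zero fun I hI ↦ by rw [hzero I hI]; simp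
    simp_rw [hl, norm_zero]
    rw [zero_pow two_ne_zero, sum_const_zero]
    refine mul_nonneg (mul_nonneg hcard hM0) (Finset.sum_nonneg fun I _ ↦ ?_)
    exact mul_nonneg (mul_nonneg (Nat.cast_nonneg _) (sq_nonneg _)) (hφ0 I)
  -- class sums
  set B : ClassGroup (𝓞 K) → ℂ := fun C ↦ ∑ I ∈ Pset with idealClass I = C, b I * (φv I : ℂ) with hB
  have hrw : ∀ ψ : AddChar (Additive (ClassGroup (𝓞 K))) ℂ,
      ∑ I ∈ Pset, b I * ψ (Additive.ofMul (idealClass I)) * (φv I : ℂ) =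
        ∑ C : ClassGroup (𝓞 K), ψ (Additive.ofMul C) * B C := by
    intro ψ
    rw [← Finset.sum_fiberwise Pset (fun I ↦ idealClass I)]
    refine Finset.sum_congr rfl fun C _ ↦ ?_
    rw [hB]; dsimp only
    rw [Finset.mul_sum]
    refine Finset.sum_congr rfl fun I hI ↦ ?_
    rw [(mem_filter.mp hI).2]; ring
  simp_rw [hrw]
  rw [sum_norm_sq_charSum_eq]
  -- Cauchy–Schwarz in each class
  have hCS : ∀ C : ClassGroup (𝓞 K), ‖B C‖ ^ 2 ≤
      (∑ I ∈ Pset with idealClass I = C, (Ideal.absNorm I : ℝ) * ‖b I‖ ^ 2 * φv I) *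
        meanValueConst K A m z y := by
    intro C
    have h1 : ‖B C‖ ≤ ∑ I ∈ Pset with idealClass I = C, ‖b I‖ * φv I := by
      refine (norm_sum_le _ _).trans (le_of_eq (Finset.sum_congr rfl fun I _ ↦ ?_))
      rw [norm_mul, Complex.norm_real, Real.norm_eq_abs, abs_of_nonneg (hφ0 I)]
    have h2 := Finset.sum_sq_le_sum_mul_sum_of_sq_le_mul (Pset.filter fun I ↦ idealClass I = C)
      (r := fun I ↦ ‖b I‖ * φv I) (f := fun I ↦ (Ideal.absNorm I : ℝ) * ‖b I‖ ^ 2 * φv I)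
      (g := fun I ↦ φv I / (Ideal.absNorm I : ℝ))
      (fun I _ ↦ mul_nonneg (mul_nonneg (Nat.cast_nonneg _) (sq_nonneg _)) (hφ0 I))
      (fun I _ ↦ div_nonneg (hφ0 I) (Nat.cast_nonneg _))
      (fun I hI ↦ by
        have hN : (0 : ℝ) < Ideal.absNorm I := by
          have := hy I (mem_filter.mp hI).1; linarith
        rw [show (‖b I‖ * φv I) ^ 2 = (Ideal.absNorm I : ℝ) * ‖b I‖ ^ 2 * φv I *
          (φv I / (Ideal.absNorm I : ℝ)) by field_simp])
    have h3 := sum_sifted_class_phi_div_le Pset C hA hm hz h0 hsft (y := y) hu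
    have h00 : 0 ≤ ∑ I ∈ Pset with idealClass I = C, (Ideal.absNorm I : ℝ) * ‖b I‖ ^ 2 * φv I :=
      Finset.sum_nonneg fun I _ ↦ mul_nonneg (mul_nonneg (Nat.cast_nonneg _) (sq_nonneg _)) (hφ0 I)
    calc ‖B C‖ ^ 2 ≤ (∑ I ∈ Pset with idealClass I = C, ‖b I‖ * φv I) ^ 2 :=
          pow_le_pow_left₀ (norm_nonneg _) h1 2
      _ ≤ _ := h2
      _ ≤ _ := mul_le_mul_of_nonneg_left h3 h00
  calc (Fintype.card (ClassGroup (𝓞 K)) : ℝ) * ∑ C : ClassGroup (𝓞 K), ‖B C‖ ^ 2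
      ≤ (Fintype.card (ClassGroup (𝓞 K)) : ℝ) * ∑ C : ClassGroup (𝓞 K),
          (∑ I ∈ Pset with idealClass I = C, (Ideal.absNorm I : ℝ) * ‖b I‖ ^ 2 * φv I) *
            meanValueConst K A m z y := mul_le_mul_of_nonneg_left (Finset.sum_le_sum fun C _ ↦ hCS C) hcard
    _ = _ := by
        rw [← Finset.sum_mul, Finset.sum_fiberwise Pset (fun I ↦ idealClass I)
          (fun I ↦ (Ideal.absNorm I : ℝ) * ‖b I‖ ^ 2 * φv I)]
        ring

/-! ### The mean value theorem -/

/-- **Thorner–Zaman Theorem 4.2 for the class group** (log-free mean value / large sieve): for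
complex `b(𝔫)` on finitely many nonzero ideals `𝔫`, all of norm `> y` and free of prime factors of
norm `≤ z` (`1 ≤ z ≤ y`), Weiss's kernel of order `m + 1 ≥ n_K + 4` and parameter `A > 0`, and
`0 < T` with `(m+1)T² ≤ 3A²`,
`Σ_ψ ∫_{−T}^{T} |Σ_𝔫 b(𝔫) ψ([𝔫]) N𝔫^{−it}|² dt ≤ 8π h_K M Σ_𝔫 N𝔫 |b(𝔫)|²`,
`M = meanValueConst K A m z y = κ₀/V'(z) + |D_z|² err(log y − (m+1)/A) z`.
[cite: ThornerZaman2017, Theorem 4.2] -/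
theorem classGroup_meanValue_le (Pset : Finset (Ideal (𝓞 K))) (b : Ideal (𝓞 K) → ℂ)
    {A : ℝ} (hA : 0 < A) {m : ℕ} (hm : Module.finrank ℚ K + 3 ≤ m) {T : ℝ} (hT : 0 < T)
    (hTA : ((m : ℝ) + 1) * T ^ 2 ≤ 3 * A ^ 2) {z y : ℝ} (hz : 1 ≤ z) (hzy : z ≤ y)
    (h0 : ∀ I ∈ Pset, I ≠ ⊥)
    (hsft : ∀ I ∈ Pset, ∀ w : HeightOneSpectrum (𝓞 K), (Ideal.absNorm w.asIdeal : ℝ) ≤ z → ¬ w.asIdeal ∣ I)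
    (hy : ∀ I ∈ Pset, y < (Ideal.absNorm I : ℝ)) :
    ∑ ψ : AddChar (Additive (ClassGroup (𝓞 K))) ℂ,
        ∫ t in -T..T, ‖∑ I ∈ Pset, b I * ψ (Additive.ofMul (idealClass I)) *
          Complex.exp (-(t * Real.log (Ideal.absNorm I)) * Complex.I)‖ ^ 2 ≤
      8 * π * (Fintype.card (ClassGroup (𝓞 K)) * meanValueConst K A m z y *
        ∑ I ∈ Pset, (Ideal.absNorm I : ℝ) * ‖b I‖ ^ 2) := by
  have hm1 : 1 ≤ m := by omega
  set l : Ideal (𝓞 K) → ℝ := fun I ↦ Real.log (Ideal.absNorm I) with hl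
  -- Gallagher per character
  have hG : ∀ ψ : AddChar (Additive (ClassGroup (𝓞 K))) ℂ,
      ∫ t in -T..T, ‖∑ I ∈ Pset, b I * ψ (Additive.ofMul (idealClass I)) *
          Complex.exp (-(t * l I) * Complex.I)‖ ^ 2 ≤
        8 * π * ∫ u, ‖∑ I ∈ Pset, b I * ψ (Additive.ofMul (idealClass I)) * (phi A m (u - l I) : ℂ)‖ ^ 2 :=
    fun ψ ↦ gallagher hA m hT hTA Pset (fun I ↦ b I * ψ (Additive.ofMul (idealClass I))) l
  refine (Finset.sum_le_sum fun ψ _ ↦ hG ψ).trans ?_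
  rw [← Finset.mul_sum, ← integral_finsetSum _ (fun ψ _ ↦ integrable_norm_sq_sum_phi hA hm1 Pset _ l)]
  refine mul_le_mul_of_nonneg_left ?_ (by positivity)
  -- integrate the pointwise bound
  have hint : Integrable fun u : ℝ ↦ Fintype.card (ClassGroup (𝓞 K)) * meanValueConst K A m z y *
      ∑ I ∈ Pset, (Ideal.absNorm I : ℝ) * ‖b I‖ ^ 2 * phi A m (u - l I) :=
    (integrable_finsetSum Pset fun I _ ↦ ((integrable_phi A m).comp_sub_right (l I)).const_mul _).const_mul _
  have hval : ∫ u : ℝ, Fintype.card (ClassGroup (𝓞 K)) * meanValueConst K A m z y *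
      ∑ I ∈ Pset, (Ideal.absNorm I : ℝ) * ‖b I‖ ^ 2 * phi A m (u - l I) =
      Fintype.card (ClassGroup (𝓞 K)) * meanValueConst K A m z y *
        ∑ I ∈ Pset, (Ideal.absNorm I : ℝ) * ‖b I‖ ^ 2 := by
    rw [integral_const_mul, integral_finsetSum _ (fun I _ ↦ ((integrable_phi A m).comp_sub_right (l I)).const_mul _)]
    congr 1
    refine Finset.sum_congr rfl fun I _ ↦ ?_
    rw [integral_const_mul, integral_sub_right_eq_self (fun u ↦ phi A m u) (l I), integral_phi hA m, mul_one]
  rw [← hval]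
  refine integral_mono_of_nonneg (Eventually.of_forall fun u ↦ Finset.sum_nonneg fun ψ _ ↦ by positivity) hint
    (Eventually.of_forall fun u ↦ ?_)
  exact sum_norm_sq_smoothed_le Pset b hA hm hz hzy h0 hsft hy u

/-- **The case of prime ideals** `v` of norm `> y ≥ z`: they are `z`-sifted. [cite: ThornerZaman2017, Theorem 4.2] -/
theorem classGroup_meanValue_primes_le (Pset : Finset (HeightOneSpectrum (𝓞 K))) (b : HeightOneSpectrum (𝓞 K) → ℂ)
    {A : ℝ} (hA : 0 < A) {m : ℕ} (hm : Module.finrank ℚ K + 3 ≤ m) {T : ℝ} (hT : 0 < T)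
    (hTA : ((m : ℝ) + 1) * T ^ 2 ≤ 3 * A ^ 2) {z y : ℝ} (hz : 1 ≤ z) (hzy : z ≤ y)
    (hy : ∀ v ∈ Pset, y < (Ideal.absNorm v.asIdeal : ℝ)) :
    ∑ ψ : AddChar (Additive (ClassGroup (𝓞 K))) ℂ,
        ∫ t in -T..T, ‖∑ v ∈ Pset, b v * ψ (Additive.ofMul (idealClass v.asIdeal)) *
          Complex.exp (-(t * Real.log (Ideal.absNorm v.asIdeal)) * Complex.I)‖ ^ 2 ≤
      8 * π * (Fintype.card (ClassGroup (𝓞 K)) * meanValueConst K A m z y *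
        ∑ v ∈ Pset, (Ideal.absNorm v.asIdeal : ℝ) * ‖b v‖ ^ 2) := by
  -- transport along the injection `v ↦ v.asIdeal`
  set e : HeightOneSpectrum (𝓞 K) → Ideal (𝓞 K) := fun v ↦ v.asIdeal with he
  have hinj : Function.Injective e := fun _ _ h ↦ HeightOneSpectrum.ext h
  set b' : Ideal (𝓞 K) → ℂ := fun I ↦ if h : ∃ v ∈ Pset, v.asIdeal = I then b h.choose else 0 with hb'
  have hb'e : ∀ v ∈ Pset, b' (e v) = b v := by
    intro v hv
    have hex : ∃ v' ∈ Pset, v'.asIdeal = e v := ⟨v, hv, rfl⟩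
    rw [hb']; dsimp only
    rw [dif_pos hex]
    congr 1
    exact hinj hex.choose_spec.2
  have h := classGroup_meanValue_le (Pset.image e) b' hA hm hT hTA hz hzy
    (fun I hI ↦ by obtain ⟨v, -, rfl⟩ := Finset.mem_image.mp hI; exact v.ne_bot)
    (fun I hI w hw ↦ by
      obtain ⟨v, hv, rfl⟩ := Finset.mem_image.mp hI
      exact not_dvd_of_absNorm_lt (lt_of_le_of_lt hzy (hy v hv)) hw)
    (fun I hI ↦ by obtain ⟨v, hv, rfl⟩ := Finset.mem_image.mp hI; exact hy v hv)
  rw [Finset.sum_image (fun v _ w _ h ↦ hinj h)] at h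
  simp_rw [Finset.sum_image (fun v _ w _ h ↦ hinj h)] at h
  have hL : ∀ ψ : AddChar (Additive (ClassGroup (𝓞 K))) ℂ,
      (fun t : ℝ ↦ ‖∑ v ∈ Pset, b v * ψ (Additive.ofMul (idealClass v.asIdeal)) *
          Complex.exp (-(t * Real.log (Ideal.absNorm v.asIdeal)) * Complex.I)‖ ^ 2) =
        fun t : ℝ ↦ ‖∑ v ∈ Pset, b' (e v) * ψ (Additive.ofMul (idealClass (e v))) *
          Complex.exp (-(t * Real.log (Ideal.absNorm (e v))) * Complex.I)‖ ^ 2 := by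
    intro ψ; funext t
    congr 2
    exact Finset.sum_congr rfl fun v hv ↦ by rw [hb'e v hv]
  have hR : ∑ v ∈ Pset, (Ideal.absNorm v.asIdeal : ℝ) * ‖b v‖ ^ 2 =
      ∑ v ∈ Pset, (Ideal.absNorm (e v) : ℝ) * ‖b' (e v)‖ ^ 2 :=
    Finset.sum_congr rfl fun v hv ↦ by rw [hb'e v hv]
  simp_rw [hL]
  rw [hR]
  exact h

end Literature.NumberTheory.LFunctions.NumberField

end
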